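import Mathlib
import HarnessLib

/-!
# Layer-cake Laplace bound from a power bound on sublevel volumes
# (helper toward the crux `TwistExponentGap.RigidTwistCeiling` ⟨stmt-QuantumFields-24054⟩; also serves `StratifiedTwistCeiling` ⟨24053⟩)

The BC3 birth skeleton of `RigidTwistCeiling` (planner ym-idea-4 g13, HOME `pub/ideators/ym-idea-4/bc/g13-A/RigidTwistCeiling_birth.lean`,
evidence on the item) splits the crux into a GEOMETRIC stub (Morse–Bott volume of the sublevel sets of the twisted Wilson action under
rigidity) and an ANALYTIC stub `stub_laplace_of_sublevel`: a power bound `μ{f ≤ t} ≤ C t^k` (`0 < t ≤ t₀`) on the sublevel volumes of a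
function on a probability space gives the matching power bound `∫ e^{−β f} dμ ≤ C' β^{−k}` on its Laplace integral for large `β`.
This file PROVES that analytic stub, with exactly the skeleton's statement (`laplace_of_sublevel`; no measurability or sign hypothesis is
needed: the hypothesis forces `f > 0` a.e., and a non-measurable integrand has Bochner integral `0`).

Proof (elementary layer cake at resolution `1/β`): a.e. `e^{−βf} ≤ Σ_{j<J} e^{−j}·1{f ≤ (j+1)/β} + e^{−J}` with `J = ⌊β t₀⌋₊`, so
`∫ e^{−βf} ≤ C β^{−k} Σ_{j<J} e^{−j}(j+1)^k + e^{−J}`; `(j+1)^k ≤ (j+1)^n ≤ n!·2ⁿ·e^{(j+1)/2}` (`n = ⌈k⌉₊`) makes the sum geometric,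
and `e^{−J} ≤ e·e^{−βt₀} ≤ e·n!·(βt₀)^{−n} ≤ e·n!·t₀^{−n}·β^{−k}` for `β ≥ 1`.
HONEST FRAMING: bookkeeping; the geometric stub (the Morse–Bott content of the crux) is untouched; no summit statement and nothing about
the Yang–Mills mass gap is proved here.  THEOREMS ONLY, standard axioms.
-/

set_option autoImplicit false

noncomputable section

open MeasureTheory Set Finset

namespace Summit.QuantumFields.YangMills.Theorems.TwistExponentGap

/-- `(j+1)^n e^{−j} ≤ n!·2ⁿ·e^{1/2} · (e^{−1/2})^j` (from `x^n/n! ≤ e^x` at `x = (j+1)/2`). -/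
theorem pow_mul_exp_neg_le (n j : ℕ) :
    ((j : ℝ) + 1) ^ n * Real.exp (-(j : ℝ)) ≤
      (n.factorial : ℝ) * 2 ^ n * Real.exp (1 / 2) * (Real.exp (-(1 / 2 : ℝ))) ^ j := by
  have hx : (0 : ℝ) ≤ ((j : ℝ) + 1) / 2 := by positivity
  have h1 := Real.pow_div_factorial_le_exp _ hx n
  have hfac : (0 : ℝ) < n.factorial := by exact_mod_cast Nat.factorial_pos n
  rw [div_pow, div_div, div_le_iff₀ (by positivity)] at h1
  -- `(j+1)^n ≤ e^{(j+1)/2} · 2^n · n!`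
  have h2 : ((j : ℝ) + 1) ^ n * Real.exp (-(j : ℝ)) ≤
      Real.exp (((j : ℝ) + 1) / 2) * (2 ^ n * n.factorial) * Real.exp (-(j : ℝ)) :=
    mul_le_mul_of_nonneg_right h1 (Real.exp_nonneg _)
  refine h2.trans (le_of_eq ?_)
  rw [← Real.exp_nat_mul]
  have e1 : Real.exp (((j : ℝ) + 1) / 2) * Real.exp (-(j : ℝ)) = Real.exp (1 / 2) * Real.exp ((j : ℕ) * -(1 / 2 : ℝ)) := by
    rw [← Real.exp_add, ← Real.exp_add]
    congr 1
    ring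
  calc Real.exp (((j : ℝ) + 1) / 2) * (2 ^ n * (n.factorial : ℝ)) * Real.exp (-(j : ℝ))
      = (n.factorial : ℝ) * 2 ^ n * (Real.exp (((j : ℝ) + 1) / 2) * Real.exp (-(j : ℝ))) := by ring
    _ = (n.factorial : ℝ) * 2 ^ n * (Real.exp (1 / 2) * Real.exp ((j : ℕ) * -(1 / 2 : ℝ))) := by rw [e1]
    _ = _ := by ring

/-- The finite layer-cake sum is bounded by a constant: `Σ_{j<J} e^{−j}(j+1)^n ≤ n!·2ⁿ·e^{1/2}/(1 − e^{−1/2})`. -/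
theorem sum_pow_mul_exp_neg_le (n J : ℕ) :
    ∑ j ∈ Finset.range J, ((j : ℝ) + 1) ^ n * Real.exp (-(j : ℝ)) ≤
      (n.factorial : ℝ) * 2 ^ n * Real.exp (1 / 2) / (1 - Real.exp (-(1 / 2 : ℝ))) := by
  set q : ℝ := Real.exp (-(1 / 2 : ℝ)) with hq
  have hq0 : 0 ≤ q := Real.exp_nonneg _
  have hq1 : q < 1 := Real.exp_lt_one_iff.2 (by norm_num)
  have hgeom : ∑ j ∈ Finset.range J, q ^ j ≤ 1 / (1 - q) := by
    have h := geom_sum_Ico_le_of_lt_one (m := 0) (n := J) hq0 hq1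
    rw [pow_zero] at h
    rw [Finset.range_eq_Ico]
    exact h
  calc ∑ j ∈ Finset.range J, ((j : ℝ) + 1) ^ n * Real.exp (-(j : ℝ))
      ≤ ∑ j ∈ Finset.range J, (n.factorial : ℝ) * 2 ^ n * Real.exp (1 / 2) * q ^ j :=
        Finset.sum_le_sum fun j _ => pow_mul_exp_neg_le n j
    _ = (n.factorial : ℝ) * 2 ^ n * Real.exp (1 / 2) * ∑ j ∈ Finset.range J, q ^ j := by rw [Finset.mul_sum]
    _ ≤ (n.factorial : ℝ) * 2 ^ n * Real.exp (1 / 2) * (1 / (1 - q)) := by gcongr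
    _ = _ := by rw [mul_one_div]

/-- `e^{−⌊βt₀⌋₊} ≤ e·n!·t₀^{−n}·β^{−k}` for `β ≥ 1`, `k ≤ n`, `t₀ > 0`. -/
theorem exp_neg_floor_le {k t₀ β : ℝ} {n : ℕ} (hkn : k ≤ n) (ht₀ : 0 < t₀) (hβ : 1 ≤ β) :
    Real.exp (-(⌊β * t₀⌋₊ : ℝ)) ≤ Real.exp 1 * n.factorial * t₀ ^ (-(n : ℝ)) * β ^ (-k) := by
  have hβ0 : 0 < β := by linarith
  have hx : 0 ≤ β * t₀ := by positivity
  -- `⌊βt₀⌋ ≥ βt₀ − 1`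
  have hfl : β * t₀ - 1 ≤ (⌊β * t₀⌋₊ : ℝ) := by
    have := Nat.lt_floor_add_one (β * t₀)
    linarith
  have h1 : Real.exp (-(⌊β * t₀⌋₊ : ℝ)) ≤ Real.exp 1 * Real.exp (-(β * t₀)) := by
    rw [← Real.exp_add]; exact Real.exp_le_exp.2 (by linarith)
  -- `e^{−βt₀} ≤ n!/(βt₀)^n`
  have hfac : (0 : ℝ) < n.factorial := by exact_mod_cast Nat.factorial_pos n
  have h2 : Real.exp (-(β * t₀)) ≤ (n.factorial : ℝ) * (β * t₀) ^ (-(n : ℝ)) := by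
    have h := Real.pow_div_factorial_le_exp _ hx n
    rw [div_le_iff₀ hfac] at h
    have hpos : 0 < (β * t₀) ^ n := pow_pos (by positivity) n
    rw [Real.exp_neg, Real.rpow_neg hx, Real.rpow_natCast, inv_le_iff_one_le_mul₀ (Real.exp_pos _)]
    calc (1 : ℝ) = (β * t₀) ^ n * ((β * t₀) ^ n)⁻¹ := by rw [mul_inv_cancel₀ hpos.ne']
      _ ≤ (Real.exp (β * t₀) * n.factorial) * ((β * t₀) ^ n)⁻¹ :=
          mul_le_mul_of_nonneg_right h (inv_nonneg.2 hpos.le)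
      _ = (n.factorial : ℝ) * ((β * t₀) ^ n)⁻¹ * Real.exp (β * t₀) := by ring
  -- `β^{−n} ≤ β^{−k}`
  have h3 : (β * t₀) ^ (-(n : ℝ)) = t₀ ^ (-(n : ℝ)) * β ^ (-(n : ℝ)) := by
    rw [Real.mul_rpow hβ0.le ht₀.le, mul_comm]
  have h4 : β ^ (-(n : ℝ)) ≤ β ^ (-k) := Real.rpow_le_rpow_of_exponent_le hβ (by linarith)
  calc Real.exp (-(⌊β * t₀⌋₊ : ℝ)) ≤ Real.exp 1 * Real.exp (-(β * t₀)) := h1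
    _ ≤ Real.exp 1 * ((n.factorial : ℝ) * (β * t₀) ^ (-(n : ℝ))) :=
        mul_le_mul_of_nonneg_left h2 (Real.exp_nonneg _)
    _ = Real.exp 1 * n.factorial * t₀ ^ (-(n : ℝ)) * β ^ (-(n : ℝ)) := by rw [h3]; ring
    _ ≤ Real.exp 1 * n.factorial * t₀ ^ (-(n : ℝ)) * β ^ (-k) := by gcongr

/-- The pointwise layer cake at resolution `1/β`: for `0 < y` (the value of `f`), `0 < β` and `J = ⌊β t₀⌋₊`,
`e^{−βy} ≤ Σ_{j<J} e^{−j}·1[y ≤ (j+1)/β] + e^{−J}`. -/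
theorem exp_neg_mul_le_layerSum {β t₀ y : ℝ} (hβ : 0 < β) (hy : 0 < y) :
    Real.exp (-(β * y)) ≤
      (∑ j ∈ Finset.range ⌊β * t₀⌋₊, Real.exp (-(j : ℝ)) * (if y ≤ ((j : ℝ) + 1) / β then 1 else 0)) +
        Real.exp (-(⌊β * t₀⌋₊ : ℝ)) := by
  set J : ℕ := ⌊β * t₀⌋₊ with hJ
  have hsum0 : 0 ≤ ∑ j ∈ Finset.range J, Real.exp (-(j : ℝ)) * (if y ≤ ((j : ℝ) + 1) / β then 1 else 0) :=
    Finset.sum_nonneg fun j _ => mul_nonneg (Real.exp_nonneg _) (by split_ifs <;> norm_num)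
  by_cases hbig : (J : ℝ) < β * y
  · -- `βy > J`: the constant tail dominates
    have : Real.exp (-(β * y)) ≤ Real.exp (-(J : ℝ)) := Real.exp_le_exp.2 (by linarith)
    linarith
  · push Not at hbig
    -- `0 < βy ≤ J`: the term `j = ⌈βy⌉₊ − 1` dominates
    have hβy : 0 < β * y := mul_pos hβ hy
    set m : ℕ := ⌈β * y⌉₊ with hm
    have hm1 : 1 ≤ m := Nat.one_le_iff_ne_zero.2 (by rw [hm]; exact Nat.ceil_pos.2 hβy |>.ne')
    have hmJ : m ≤ J := by
      rw [hm]; exact Nat.ceil_le.2 (by exact_mod_cast hbig)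
    have hjmem : m - 1 ∈ Finset.range J := Finset.mem_range.2 (by omega)
    have hyle : y ≤ (((m - 1 : ℕ) : ℝ) + 1) / β := by
      rw [le_div_iff₀ hβ, Nat.cast_sub hm1, Nat.cast_one, sub_add_cancel, mul_comm]
      exact Nat.le_ceil _
    have hterm : Real.exp (-(β * y)) ≤ Real.exp (-(((m - 1 : ℕ) : ℝ))) * (if y ≤ (((m - 1 : ℕ) : ℝ) + 1) / β then 1 else 0) := by
      rw [if_pos hyle, mul_one]
      refine Real.exp_le_exp.2 ?_
      have : ((m : ℕ) : ℝ) < β * y + 1 := Nat.ceil_lt_add_one hβy.le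
      rw [Nat.cast_sub hm1, Nat.cast_one]
      linarith
    have hle : Real.exp (-(((m - 1 : ℕ) : ℝ))) * (if y ≤ (((m - 1 : ℕ) : ℝ) + 1) / β then 1 else 0) ≤
        ∑ j ∈ Finset.range J, Real.exp (-(j : ℝ)) * (if y ≤ ((j : ℝ) + 1) / β then 1 else 0) :=
      Finset.single_le_sum (f := fun j : ℕ => Real.exp (-(j : ℝ)) * (if y ≤ ((j : ℝ) + 1) / β then (1 : ℝ) else 0))
        (fun j _ => mul_nonneg (Real.exp_nonneg _) (by split_ifs <;> norm_num)) hjmem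
    linarith [Real.exp_nonneg (-(J : ℝ))]

/-- **The analytic stub `stub_laplace_of_sublevel` of the `RigidTwistCeiling` birth skeleton, PROVED** (letter for letter): on a
probability space, `μ{f ≤ t} ≤ C t^k` for `0 < t ≤ t₀` (`k > 0`) implies `∫ e^{−βf} dμ ≤ C' β^{−k}` for `β ≥ β₀` (here `β₀ = 1` and
`C' = C·n!·2ⁿ·e^{1/2}/(1 − e^{−1/2}) + e·n!·t₀^{−n}`, `n = ⌈k⌉₊`). -/
theorem laplace_of_sublevel :
    ∀ (X : Type) [MeasurableSpace X] (μ : Measure X) [IsProbabilityMeasure μ] (f : X → ℝ) (k C t₀ : ℝ),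
      0 < k → 0 < t₀ → (∀ t : ℝ, 0 < t → t ≤ t₀ → (μ {x | f x ≤ t}).toReal ≤ C * t ^ k) →
      ∃ C' β₀ : ℝ, ∀ β : ℝ, β₀ ≤ β → ∫ x, Real.exp (-(β * f x)) ∂μ ≤ C' * β ^ (-k) := by
  intro X _ μ _ f k C t₀ hk ht₀ hsub
  -- `C ≥ 0` (from the hypothesis at `t = t₀`)
  have hC0 : 0 ≤ C := by
    have h := hsub t₀ ht₀ le_rfl
    have hpos : 0 < t₀ ^ k := Real.rpow_pos_of_pos ht₀ k
    nlinarith [ENNReal.toReal_nonneg (a := μ {x | f x ≤ t₀})]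
  set n : ℕ := ⌈k⌉₊ with hn
  have hkn : k ≤ n := Nat.le_ceil k
  set A : ℝ := (n.factorial : ℝ) * 2 ^ n * Real.exp (1 / 2) / (1 - Real.exp (-(1 / 2 : ℝ))) with hA
  set B : ℝ := Real.exp 1 * n.factorial * t₀ ^ (-(n : ℝ)) with hB
  have hA0 : 0 ≤ A := by
    have : Real.exp (-(1 / 2 : ℝ)) < 1 := Real.exp_lt_one_iff.2 (by norm_num)
    rw [hA]; exact div_nonneg (by positivity) (by linarith)
  have hB0 : 0 ≤ B := by rw [hB]; positivity
  refine ⟨C * A + B, 1, fun β hβ => ?_⟩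
  have hβ0 : 0 < β := by linarith
  have hβk : 0 < β ^ (-k) := Real.rpow_pos_of_pos hβ0 _
  -- the target constant is non-negative, which settles the degenerate (non-measurable) case
  have hRHS0 : 0 ≤ (C * A + B) * β ^ (-k) := by positivity
  -- `f > 0` almost everywhere
  have hnull : μ {x | f x ≤ 0} = 0 := by
    rw [← nonpos_iff_eq_zero]
    refine le_of_forall_pos_le_add fun ε hε => ?_
    -- choose `t` small with `C t^k < ε`
    obtain ⟨t, ht, htt₀, hCt⟩ : ∃ t : ℝ, 0 < t ∧ t ≤ t₀ ∧ (C * t ^ k < ε.toReal ∨ ε = ⊤) := by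
      by_cases hε' : ε = ⊤
      · exact ⟨t₀, ht₀, le_rfl, Or.inr hε'⟩
      · have hεr : 0 < ε.toReal := ENNReal.toReal_pos hε.ne' hε'
        -- `t = min t₀ ((ε/(C+1))^{1/k} / 2)`-type choice via continuity at 0: use `t ^ k → 0`
        have hlim : Filter.Tendsto (fun t : ℝ => C * t ^ k) (nhdsWithin 0 (Set.Ioi 0)) (nhds (C * 0)) := by
          have h0 : Filter.Tendsto (fun t : ℝ => t ^ k) (nhdsWithin 0 (Set.Ioi 0)) (nhds 0) := by
            have := (Real.continuousAt_rpow_const (0 : ℝ) k (Or.inr hk.le)).tendsto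
            rw [Real.zero_rpow hk.ne'] at this
            exact this.mono_left nhdsWithin_le_nhds
          exact h0.const_mul C
        rw [mul_zero] at hlim
        have hev : ∀ᶠ t : ℝ in nhdsWithin 0 (Set.Ioi 0), C * t ^ k < ε.toReal := hlim.eventually (gt_mem_nhds hεr)
        have hev2 : ∀ᶠ t : ℝ in nhdsWithin 0 (Set.Ioi 0), t ≤ t₀ :=
          mem_nhdsWithin_of_mem_nhds (Iic_mem_nhds ht₀)
        obtain ⟨t, ⟨h1, h2⟩, h3⟩ := ((hev.and hev2).and self_mem_nhdsWithin).exists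
        exact ⟨t, h3, h2, Or.inl h1⟩
    have hmono : μ {x | f x ≤ 0} ≤ μ {x | f x ≤ t} := measure_mono fun x (hx : f x ≤ 0) => hx.trans ht.le
    rcases hCt with hCt | hεtop
    · have hfin : μ {x | f x ≤ t} ≠ ⊤ := measure_ne_top μ _
      have h1 : μ {x | f x ≤ t} ≤ ε := by
        rw [← ENNReal.ofReal_toReal hfin]
        have hle : (μ {x | f x ≤ t}).toReal ≤ ε.toReal := ((hsub t ht htt₀).trans hCt.le)
        calc ENNReal.ofReal (μ {x | f x ≤ t}).toReal ≤ ENNReal.ofReal ε.toReal := ENNReal.ofReal_le_ofReal hle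
          _ ≤ ε := ENNReal.ofReal_toReal_le
      exact hmono.trans (h1.trans le_add_self)
    · rw [hεtop]; exact le_top.trans le_add_self
  have hpos_ae : ∀ᵐ x ∂μ, 0 < f x := by
    have : ∀ᵐ x ∂μ, x ∉ {x | f x ≤ 0} := measure_eq_zero_iff_ae_notMem.1 hnull
    filter_upwards [this] with x hx
    exact not_le.1 hx
  -- the non-measurable case is trivial
  by_cases hfm : AEStronglyMeasurable (fun x => Real.exp (-(β * f x))) μ
  swap
  · rw [integral_non_aestronglyMeasurable hfm]; exact hRHS0
  -- an a.e.-equal measurable modification `g` of `f`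
  have hfam : AEMeasurable f μ := by
    have h1 : AEMeasurable (fun x => Real.exp (-(β * f x))) μ := hfm.aemeasurable
    have h2 : AEMeasurable (fun x => -Real.log (Real.exp (-(β * f x))) / β) μ :=
      ((Real.measurable_log.comp_aemeasurable h1).neg).div_const β
    refine h2.congr (Filter.Eventually.of_forall fun x => ?_)
    simp only [Real.log_exp]
    field_simp
  set g : X → ℝ := hfam.mk f with hg
  have hgm : Measurable g := hfam.measurable_mk
  have hfg : f =ᵐ[μ] g := hfam.ae_eq_mk
  set J : ℕ := ⌊β * t₀⌋₊ with hJ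
  -- the dominating simple function
  set Gfun : X → ℝ := fun x =>
    (∑ j ∈ Finset.range J, Real.exp (-(j : ℝ)) * (if g x ≤ ((j : ℝ) + 1) / β then 1 else 0)) +
      Real.exp (-(J : ℝ)) with hGfun
  have hset : ∀ c : ℝ, MeasurableSet {x | g x ≤ c} := fun c => hgm measurableSet_Iic
  have hind : ∀ (j : ℕ), (fun x => (if g x ≤ ((j : ℝ) + 1) / β then (1 : ℝ) else 0)) =
      Set.indicator {x | g x ≤ ((j : ℝ) + 1) / β} 1 := by
    intro j; funext x; simp only [Set.indicator, Set.mem_setOf_eq, Pi.one_apply]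
  have hint_ind : ∀ j : ℕ, Integrable (fun x => (if g x ≤ ((j : ℝ) + 1) / β then (1 : ℝ) else 0)) μ := by
    intro j; rw [hind j]; exact (integrable_const (1 : ℝ)).indicator (hset _)
  have hGint : Integrable Gfun μ := by
    refine (integrable_finsetSum _ fun j _ => (hint_ind j).const_mul _).add (integrable_const _)
  -- (1) pointwise a.e. domination
  have hdom : (fun x => Real.exp (-(β * f x))) ≤ᵐ[μ] Gfun := by
    filter_upwards [hpos_ae, hfg] with x hx hxg
    have h := exp_neg_mul_le_layerSum (t₀ := t₀) hβ0 hx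
    simp only [hGfun, ← hxg]
    exact h
  have hnn : 0 ≤ᵐ[μ] fun x => Real.exp (-(β * f x)) := Filter.Eventually.of_forall fun x => Real.exp_nonneg _
  have hstep1 : ∫ x, Real.exp (-(β * f x)) ∂μ ≤ ∫ x, Gfun x ∂μ := integral_mono_of_nonneg hnn hGint hdom
  -- (2) integrate the simple function
  have hGval : ∫ x, Gfun x ∂μ =
      (∑ j ∈ Finset.range J, Real.exp (-(j : ℝ)) * (μ {x | g x ≤ ((j : ℝ) + 1) / β}).toReal) + Real.exp (-(J : ℝ)) := by
    simp only [hGfun]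
    rw [integral_add (integrable_finsetSum _ fun j _ => (hint_ind j).const_mul _) (integrable_const _),
      integral_const, probReal_univ, one_smul, integral_finsetSum _ fun j _ => (hint_ind j).const_mul _]
    congr 1
    refine Finset.sum_congr rfl fun j _ => ?_
    rw [integral_const_mul, hind j, integral_indicator_one (hset _), Measure.real]
  -- (3) sublevel bounds: the sets for `g` and `f` have the same measure
  have hmeas_eq : ∀ c : ℝ, μ {x | g x ≤ c} = μ {x | f x ≤ c} := by
    intro c
    refine measure_congr ?_
    filter_upwards [hfg] with x hx
    show (x ∈ {x | g x ≤ c}) = (x ∈ {x | f x ≤ c})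
    simp only [Set.mem_setOf_eq, hx]
  have hterm : ∀ j ∈ Finset.range J,
      Real.exp (-(j : ℝ)) * (μ {x | g x ≤ ((j : ℝ) + 1) / β}).toReal ≤
        C * β ^ (-k) * (((j : ℝ) + 1) ^ n * Real.exp (-(j : ℝ))) := by
    intro j hj
    have hjJ : j < J := Finset.mem_range.1 hj
    have htpos : 0 < ((j : ℝ) + 1) / β := by positivity
    have htle : ((j : ℝ) + 1) / β ≤ t₀ := by
      rw [div_le_iff₀ hβ0]
      have h1 : ((j : ℝ) + 1) ≤ (J : ℝ) := by exact_mod_cast hjJ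
      have h2 : (J : ℝ) ≤ β * t₀ := Nat.floor_le (by positivity)
      linarith
    have hμ := hsub _ htpos htle
    rw [hmeas_eq]
    have hrpow : (((j : ℝ) + 1) / β) ^ k = ((j : ℝ) + 1) ^ k * β ^ (-k) := by
      rw [Real.div_rpow (by positivity) hβ0.le, Real.rpow_neg hβ0.le, div_eq_mul_inv]
    have hjk : ((j : ℝ) + 1) ^ k ≤ ((j : ℝ) + 1) ^ (n : ℝ) :=
      Real.rpow_le_rpow_of_exponent_le (by linarith [Nat.cast_nonneg (α := ℝ) j]) hkn
    rw [Real.rpow_natCast] at hjk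
    calc Real.exp (-(j : ℝ)) * (μ {x | f x ≤ ((j : ℝ) + 1) / β}).toReal
        ≤ Real.exp (-(j : ℝ)) * (C * (((j : ℝ) + 1) / β) ^ k) := mul_le_mul_of_nonneg_left hμ (Real.exp_nonneg _)
      _ = C * β ^ (-k) * (((j : ℝ) + 1) ^ k * Real.exp (-(j : ℝ))) := by rw [hrpow]; ring
      _ ≤ C * β ^ (-k) * (((j : ℝ) + 1) ^ n * Real.exp (-(j : ℝ))) := by gcongr
  have hstep2 : ∫ x, Gfun x ∂μ ≤ C * β ^ (-k) * A + B * β ^ (-k) := by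
    rw [hGval]
    have hS := Finset.sum_le_sum hterm
    rw [← Finset.mul_sum] at hS
    have hA' := sum_pow_mul_exp_neg_le n J
    have hJ' := exp_neg_floor_le (n := n) hkn ht₀ hβ
    calc (∑ j ∈ Finset.range J, Real.exp (-(j : ℝ)) * (μ {x | g x ≤ ((j : ℝ) + 1) / β}).toReal) + Real.exp (-(J : ℝ))
        ≤ C * β ^ (-k) * (∑ j ∈ Finset.range J, ((j : ℝ) + 1) ^ n * Real.exp (-(j : ℝ))) +
            Real.exp 1 * n.factorial * t₀ ^ (-(n : ℝ)) * β ^ (-k) := add_le_add hS hJ'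
      _ ≤ C * β ^ (-k) * A + B * β ^ (-k) := by
          rw [hB]; gcongr
  calc ∫ x, Real.exp (-(β * f x)) ∂μ ≤ ∫ x, Gfun x ∂μ := hstep1
    _ ≤ C * β ^ (-k) * A + B * β ^ (-k) := hstep2
    _ = (C * A + B) * β ^ (-k) := by ring

end Summit.QuantumFields.YangMills.Theorems.TwistExponentGap

end
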